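import Mathlib
import HarnessLib
import Summits.HubbardSuperconductivity.HubbardSuperconductivity.Theorems.KLProgrammeKLRegimeEngineStepValuesResidueV17F2G
import Summits.HubbardSuperconductivity.HubbardSuperconductivity.Theorems.KLProgrammeKLRegimeEngineV8DefsU12bGQ
import Summits.HubbardSuperconductivity.HubbardSuperconductivity.Theorems.KLProgrammeKLRegimeEngineV8DefsQ9dG
import Summits.HubbardSuperconductivity.HubbardSuperconductivity.Theorems.KLProgrammeKLRegimeEngineV8DefsG14
import Summits.HubbardSuperconductivity.HubbardSuperconductivity.Theorems.KLProgrammeKLRegimeEngineV8DefsU4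
import Summits.HubbardSuperconductivity.HubbardSuperconductivity.Theorems.KLProgrammeKLRegimeEngineV8DefsL4
import Summits.HubbardSuperconductivity.HubbardSuperconductivity.Theorems.KLProgrammeKLRegimeEngineV8DefsG10
import Summits.HubbardSuperconductivity.HubbardSuperconductivity.Theorems.KLProgrammeKLRegimeEngineV8TowerExports2
import Summits.HubbardSuperconductivity.HubbardSuperconductivity.Theorems.KLProgrammeKLRegimeEngineV8IsoTupleExportB
import Summits.HubbardSuperconductivity.HubbardSuperconductivity.Theorems.KLProgrammeKLRegimeEngineV8PairTransferExport8
import Summits.HubbardSuperconductivity.HubbardSuperconductivity.Theorems.KLProgrammeKLRegimeEngineKernelNormsWt4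
import Summits.HubbardSuperconductivity.HubbardSuperconductivity.Theorems.KLProgrammeKLRegimeEngineWtBudget

/-!
# K3 ENGINE (stmt-HubbardSuperconductivity-20437 `KLRegimeEngineV17F2`, V2 registration 27cd7ed0f55f17c0): the (c) CLOSER-MODULO-PRODUCERS
# AT `(G, klEngQ9dG G P R)` and its instance at the REGISTERED tokens `(klEngGeo14, klEngQ9dG klEngGeo14 P R)` — row (c) `stub_engine_step_values` VERBATIM
# (cell gate-hubbard-kl, seat hubbard-kl-k3c2-p2 g24 = the (c) value-lane closer lineage; CLOSING-MAP-r16 row (c))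

WHAT.  The (b) and (C) rows of the endgame have closers-modulo-producers in registered shape (`…EngineV17F2ClosersGQ` §2 `stub_engine_step_norms_of_producers_GQd`,
`…EngineV17F2ClosersCGQ(Inst)` `stub_twoLeg_curvature_of_producers`); the (c) row had only the MODEL-LEVEL closer `KLRegimeSplit.stepValuesV17F2_of_residue_G / _klEngGeo14`
(…EngineStepValuesResidueV17F2G, keyed `hcU' hUb hhist hlad hout hE5`).  This file is the missing twin:
* §1 **`stub_engine_step_values_of_producers_GQd G hbhi0 hbhi hpkg hexLad hexOut hexIso`** — row (c) at `(G, klEngQ9dG G P R)` for any `G` with `0 ≤ G.bhi ≤ 2²⁴` and the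
  in-class package line, from THREE residual rows stated under row (c)'s own binder prefix: `hexLad` (E2-F2)ₙ, `hexOut` the out-of-class half of (E2″-F)ₙ (bars at
  `(G, klEngQ9dG G P R)`), `hexIso` (E5-F)ₙ.  DISCHARGED IN-TEXT: the value lane's two smallness lines (`(C_W + klLegKappa·Q.CR·Klam³)|U| ≤ 1/10` by token #14's
  `klValU` entry at `Q = klEngQ9dG G P R` — «(c)-HCU-QCR»; `|U|·G.bhi ≤ 1/8` by `klEngU₀12GQ ≤ klEngU₀4`), `(klEngQ9dG G P R).WF`, the package line, and the (B1-F) array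
  at `n−1` (read from `HistP` inside `stepValuesV17F2_of_residue_G`); the in-class half of (E2″-F)ₙ and the quartic increment are DERIVED there (…ValueClausesV17FLadder).
* §2 **`EngineV8.A24a1G14.stub_engine_step_values_of_producers hexLad hexOut hexIso`** — conclusion = row (c) of the V2 image BYTE-VERBATIM (`klEngGeo14.bhi = 2²⁴`,
  `klg14_package_ineq_of_isPairClassAt`).  Landing-day credit shape: `theorem stub_engine_step_values : <row (c)> := A24a1G14.stub_engine_step_values_of_producers hexLad hexOut hexIso`.
OWNERS of the three rows (CLOSING-MAP-r16): `hexLad` ← class #5 (`pairLadderStepAtV17F2_of_relFamilyK5_klCT8` on the stub's `htr`, modulo the resolvent-tower package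
`htower/hC₀/hsm₀` = «88b»/«95v2» + E1); `hexOut` ← this lane's `outClass_hout_klEngGeo14_of_shares_split3` modulo E1's (N₄-PATH) row (`outClass_apriori_blocks_of_quarticPathRow`,
p693922) and the (E4)-DRESSED-SPLIT sizes; `hexIso` ← class #6 / the iso door (`stepValuesV17F2_of_residue_towerLine_G`'s `hfix` + `hsmall`).
NOT A MOTION and NOT a stub credit: nothing registered here; the three rows are HYPOTHESES.  Bookkeeping composition of landed lemmas; nothing about the model is asserted;
nothing asserts (c), any open row of 20437, K3, the theorem half or superconductivity in the Hubbard model.  0 kit · 0 lit.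
-/

noncomputable section

namespace Summit.HubbardSuperconductivity.HubbardSuperconductivity.Theorems.EngineV8

set_option linter.dupNamespace false -- summit = problem name (single-conjunct summit), D-0017

open Real Finset Literature.MathematicalPhysics.QuantumLattice Literature.Probability.LatticeModels
open Literature.MathematicalPhysics.QuantumLattice.FermiRG
open Summit.HubbardSuperconductivity.HubbardSuperconductivity.Theorems.KLProgrammeLegKernels
open Summit.HubbardSuperconductivity.HubbardSuperconductivity.Theorems.DispersionFlow
open Summit.HubbardSuperconductivity.HubbardSuperconductivity.Theorems.KLRegimeSplit

/-! ## §1 Stub (c) at `(G, klEngQ9dG G P R)` from its three residual producer rows (registered currency) -/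

/-- **STUB (c) AT `(G, klEngQ9dG G P R)` FROM ITS THREE RESIDUAL PRODUCER ROWS** — for any package `G` with `0 ≤ G.bhi ≤ 2²⁴` and the in-class package line
`G.aplus·G.ζ(n−1) + 10·G.bhi ≤ G.ppGain n |Qm|` (landed for `klEngGeo11/13/14`): the value-lane closer `stepValuesV17F2_of_residue_G` under row (c)'s OWN binder list,
with the two smallness lines DISCHARGED from token #14 (`klEngU₀12GQ_le_klValU` ∘ `hcU_of_le_klValU_wf` at `Q = klEngQ9dG G P R`; `klEngU₀12GQ_le_klEngU₀4` ∘
`abs_mul_two_pow_24_le_of_le_klEngU₀4`), `Q.WF` from `klEngQ9dG_wf`, the (B1-F) array at `n − 1` from `HistP` (inside the closer).  The three hypotheses are the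
residual MODEL rows, each stated under row (c)'s binder prefix VERBATIM (so their producers may read every public input the stub has):
`hexLad` = (E2-F2)ₙ at `(G, klEngQ9dG G P R)` (class #5: `pairLadderStepAtV17F2_of_relFamilyK5_klCT8` on `htr` modulo its resolvent-tower package `htower/hC₀/hsm₀`),
`hexOut` = the OUT-OF-CLASS half of (E2″-F)ₙ (value lane: `outClass_hout_klEngGeo14_of_shares_split3` modulo E1's (N₄-PATH)/(E4)-DRESSED-SPLIT rows),
`hexIso` = (E5-F)ₙ (class #6 / iso door `isoTupleL1AtV17F_of_fixedTuple_le_hist`).  Hypotheses, not assertions. -/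
theorem stub_engine_step_values_of_producers_GQd (G : GeoConsts) (hbhi0 : 0 ≤ G.bhi) (hbhi : G.bhi ≤ 2 ^ 24)
    (hpkg : ∀ (L : ℕ) (Qm : TorusSite 2 L) (n : ℕ), IsPairClassAt L Qm n → G.aplus * G.ζ (n - 1) + 10 * G.bhi ≤ G.ppGain n (klTorusNorm L Qm))
    (hexLad : ∀ (P : SplitConsts) (R : RenConsts) (c : ℝ), P.WF → R.WF2 → 0 < c → c ≤ klEngC₃7GU G P R →
          ∀ μ ∈ klWindowC, ∀ U : ℝ, 0 < U → U ≤ klEngU₀12GQ G (klEngQ9dG G P R) P R c → ∀ β : ℝ, klBetaMin ≤ β → β ≤ Real.exp (c / U ^ 2) →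
            ∀ (L M : ℕ) [NeZero L] [NeZero M], klEngL₄ P R β U ≤ L → klEngM₃ β U L ≤ M →
              ∀ n : ℕ, 1 ≤ n → n ≤ nScales β + 1 → IsKLRegime U c (-(n : ℤ)) →
                HistP klPredsV17F2 L M G P (klEngQ9dG G P R) R β U μ 0 n →
                  FrameOK R U (nScales β) μ (klFlowFrameU L M β U μ n) →
                    KernelNormsV4 L M P (klEngQ9dG G P R) β U μ (klFlowFrameU L M β U μ n) n →
                      (∀ j ≤ n, (KernelNormsLevels L M P (klEngQ9dG G P R) β U μ (klFlowFrameU L M β U μ n) j ∧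
                        KernelNormsWt4 L M (klWtBudget P (klEngQ9dG G P R) U j) β U μ (klFlowFrameU L M β U μ n) j)) →
                        (∀ j ≤ n, LevelsUExportMixedAt L M (klCU2 P R (klEngQ7 P R)) P β U μ j) →
                          (∀ j ≤ n, IsoTupleLineBAt L M klE5AM klE5cM (klE5dM P R) P β U μ j) →
                            (∀ j ≤ n, PairTransferRelFamilyK5 L M klEngGeoTh P (klCT8 P R (klEngQ7 P R) G klEngGeoTh) β U μ j) →
            PairLadderStepAtV17F2 L M G P (klEngQ9dG G P R) β U μ n)
    (hexOut : ∀ (P : SplitConsts) (R : RenConsts) (c : ℝ), P.WF → R.WF2 → 0 < c → c ≤ klEngC₃7GU G P R →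
          ∀ μ ∈ klWindowC, ∀ U : ℝ, 0 < U → U ≤ klEngU₀12GQ G (klEngQ9dG G P R) P R c → ∀ β : ℝ, klBetaMin ≤ β → β ≤ Real.exp (c / U ^ 2) →
            ∀ (L M : ℕ) [NeZero L] [NeZero M], klEngL₄ P R β U ≤ L → klEngM₃ β U L ≤ M →
              ∀ n : ℕ, 1 ≤ n → n ≤ nScales β + 1 → IsKLRegime U c (-(n : ℤ)) →
                HistP klPredsV17F2 L M G P (klEngQ9dG G P R) R β U μ 0 n →
                  FrameOK R U (nScales β) μ (klFlowFrameU L M β U μ n) →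
                    KernelNormsV4 L M P (klEngQ9dG G P R) β U μ (klFlowFrameU L M β U μ n) n →
                      (∀ j ≤ n, (KernelNormsLevels L M P (klEngQ9dG G P R) β U μ (klFlowFrameU L M β U μ n) j ∧
                        KernelNormsWt4 L M (klWtBudget P (klEngQ9dG G P R) U j) β U μ (klFlowFrameU L M β U μ n) j)) →
                        (∀ j ≤ n, LevelsUExportMixedAt L M (klCU2 P R (klEngQ7 P R)) P β U μ j) →
                          (∀ j ≤ n, IsoTupleLineBAt L M klE5AM klE5cM (klE5dM P R) P β U μ j) →
                            (∀ j ≤ n, PairTransferRelFamilyK5 L M klEngGeoTh P (klCT8 P R (klEngQ7 P R) G klEngGeoTh) β U μ j) →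
            ∀ Qm : TorusSite 2 L, ¬ IsPairClassAt L Qm n → ∀ k ∈ klBall L μ 0, ∀ k' ∈ klBall L μ 0,
              ‖klPairAmplitude L M β U μ (klFlowFrameU L M β U μ n) n Qm k k' -
                  klPairAmplitude L M β U μ (klFlowFrameU L M β U μ (n - 1)) (n - 1) Qm k k'‖ ≤
                gainBar G P U n (klTorusNorm L Qm) (klTorusNorm L (k - k')) (klTorusNorm L (k + k' - Qm)) +
                  eremBar G P (klEngQ9dG G P R) U β L (n - 1) + thermalBar G P U β n +
                    legDressBarQ2 G P (klEngQ9dG G P R) U n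
                      (legSliceCountT L β μ (klFlowFrameU L M β U μ n) n ![k', Qm - k', Qm - k, k]) +
                      frameShiftBar P (klEngQ9dG G P R) U n)
    (hexIso : ∀ (P : SplitConsts) (R : RenConsts) (c : ℝ), P.WF → R.WF2 → 0 < c → c ≤ klEngC₃7GU G P R →
          ∀ μ ∈ klWindowC, ∀ U : ℝ, 0 < U → U ≤ klEngU₀12GQ G (klEngQ9dG G P R) P R c → ∀ β : ℝ, klBetaMin ≤ β → β ≤ Real.exp (c / U ^ 2) →
            ∀ (L M : ℕ) [NeZero L] [NeZero M], klEngL₄ P R β U ≤ L → klEngM₃ β U L ≤ M →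
              ∀ n : ℕ, 1 ≤ n → n ≤ nScales β + 1 → IsKLRegime U c (-(n : ℤ)) →
                HistP klPredsV17F2 L M G P (klEngQ9dG G P R) R β U μ 0 n →
                  FrameOK R U (nScales β) μ (klFlowFrameU L M β U μ n) →
                    KernelNormsV4 L M P (klEngQ9dG G P R) β U μ (klFlowFrameU L M β U μ n) n →
                      (∀ j ≤ n, (KernelNormsLevels L M P (klEngQ9dG G P R) β U μ (klFlowFrameU L M β U μ n) j ∧
                        KernelNormsWt4 L M (klWtBudget P (klEngQ9dG G P R) U j) β U μ (klFlowFrameU L M β U μ n) j)) →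
                        (∀ j ≤ n, LevelsUExportMixedAt L M (klCU2 P R (klEngQ7 P R)) P β U μ j) →
                          (∀ j ≤ n, IsoTupleLineBAt L M klE5AM klE5cM (klE5dM P R) P β U μ j) →
                            (∀ j ≤ n, PairTransferRelFamilyK5 L M klEngGeoTh P (klCT8 P R (klEngQ7 P R) G klEngGeoTh) β U μ j) →
            IsoTupleL1AtV17F L M G P β U μ n) :
    ∀ (P : SplitConsts) (R : RenConsts) (c : ℝ), P.WF → R.WF2 → 0 < c → c ≤ klEngC₃7GU G P R →
      ∀ μ ∈ klWindowC, ∀ U : ℝ, 0 < U → U ≤ klEngU₀12GQ G (klEngQ9dG G P R) P R c → ∀ β : ℝ, klBetaMin ≤ β → β ≤ Real.exp (c / U ^ 2) →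
        ∀ (L M : ℕ) [NeZero L] [NeZero M], klEngL₄ P R β U ≤ L → klEngM₃ β U L ≤ M →
          ∀ n : ℕ, 1 ≤ n → n ≤ nScales β + 1 → IsKLRegime U c (-(n : ℤ)) →
            HistP klPredsV17F2 L M G P (klEngQ9dG G P R) R β U μ 0 n →
              FrameOK R U (nScales β) μ (klFlowFrameU L M β U μ n) →
                KernelNormsV4 L M P (klEngQ9dG G P R) β U μ (klFlowFrameU L M β U μ n) n →
                  (∀ j ≤ n, (KernelNormsLevels L M P (klEngQ9dG G P R) β U μ (klFlowFrameU L M β U μ n) j ∧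
                    KernelNormsWt4 L M (klWtBudget P (klEngQ9dG G P R) U j) β U μ (klFlowFrameU L M β U μ n) j)) →
                    (∀ j ≤ n, LevelsUExportMixedAt L M (klCU2 P R (klEngQ7 P R)) P β U μ j) →
                      (∀ j ≤ n, IsoTupleLineBAt L M klE5AM klE5cM (klE5dM P R) P β U μ j) →
                        (∀ j ≤ n, PairTransferRelFamilyK5 L M klEngGeoTh P (klCT8 P R (klEngQ7 P R) G klEngGeoTh) β U μ j) →
                  PairLadderStepAtV17F2 L M G P (klEngQ9dG G P R) β U μ n ∧
                    PairValueIncrementAtV17F L M G P (klEngQ9dG G P R) β U μ n ∧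
                      QuarticValueIncrementAtV17F L M G P (klEngQ9dG G P R) β U μ n ∧
                        IsoTupleL1AtV17F L M G P β U μ n := by
  intro P R c hP hR hc hc3 μ hμ U hU hUle β hβ hβc L M _ _ hL hM n hn1 hn hreg hhist hfr hV4 hlev hlevU hiso htr
  have hQ : (klEngQ9dG G P R).WF := klEngQ9dG_wf G P R
  -- the two smallness lines of the value lane, from token #14 at `(G, klEngQ9dG G P R)`
  have hcU' : (P.C_W + klLegKappa * (klEngQ9dG G P R).CR * P.Klam ^ 3) * |U| ≤ 1 / 10 :=
    hcU_of_le_klValU_wf hP hQ.2.1 hU (hUle.trans (klEngU₀12GQ_le_klValU G _ P R c))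
  have hU24 : |U| * 2 ^ 24 ≤ 1 / 8 := abs_mul_two_pow_24_le_of_le_klEngU₀4 hU (hUle.trans (klEngU₀12GQ_le_klEngU₀4 G _ P R c))
  have hUb : |U| * G.bhi ≤ 1 / 8 := (mul_le_mul_of_nonneg_left hbhi (abs_nonneg U)).trans hU24
  -- the three residual rows, read under the stub's own binders
  have hlad := hexLad P R c hP hR hc hc3 μ hμ U hU hUle β hβ hβc L M hL hM n hn1 hn hreg hhist hfr hV4 hlev hlevU hiso htr
  have hout := hexOut P R c hP hR hc hc3 μ hμ U hU hUle β hβ hβc L M hL hM n hn1 hn hreg hhist hfr hV4 hlev hlevU hiso htr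
  have hE5 := hexIso P R c hP hR hc hc3 μ hμ U hU hUle β hβ hβc L M hL hM n hn1 hn hreg hhist hfr hV4 hlev hlevU hiso htr
  exact stepValuesV17F2_of_residue_G hbhi0 hP hQ hn1 hcU' hUb (fun Qm hQm => hpkg L Qm n hQm) hhist hlad hout hE5

end Summit.HubbardSuperconductivity.HubbardSuperconductivity.Theorems.EngineV8

/-! ## §2 The instance at the REGISTERED tokens `(klEngGeo14, klEngQ9dG klEngGeo14 P R)` — row (c) of the V2 image 27cd7ed0f55f17c0 VERBATIM -/

namespace Summit.HubbardSuperconductivity.HubbardSuperconductivity.Theorems.EngineV8.A24a1G14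

set_option linter.dupNamespace false -- summit = problem name (single-conjunct summit), D-0017

open Real Finset Literature.MathematicalPhysics.QuantumLattice Literature.Probability.LatticeModels
open Literature.MathematicalPhysics.QuantumLattice.FermiRG
open Summit.HubbardSuperconductivity.HubbardSuperconductivity.Theorems.KLProgrammeLegKernels
open Summit.HubbardSuperconductivity.HubbardSuperconductivity.Theorems.DispersionFlow
open Summit.HubbardSuperconductivity.HubbardSuperconductivity.Theorems.KLRegimeSplit
open Summit.HubbardSuperconductivity.HubbardSuperconductivity.Theorems.EngineV8

/-- **ROW (c) `stub_engine_step_values` OF THE V2 IMAGE 27cd7ed0f55f17c0 (stmt-HubbardSuperconductivity-20437), MODULO ITS THREE RESIDUAL PRODUCER ROWS** —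
the conclusion is the registered (c) text BYTE-VERBATIM; `stub_engine_step_values_of_producers_GQd klEngGeo14` with `klEngGeo14.bhi = 2²⁴` and the package line
`klg14_package_ineq_of_isPairClassAt`.  Credit one-liner on landing day (registrant): `theorem stub_engine_step_values : <row (c)> :=
A24a1G14.stub_engine_step_values_of_producers hexLad hexOut hexIso` once the three rows are theorems.  NOT a stub credit: the three rows are HYPOTHESES here. -/
theorem stub_engine_step_values_of_producers
    (hexLad : ∀ (P : SplitConsts) (R : RenConsts) (c : ℝ), P.WF → R.WF2 → 0 < c → c ≤ klEngC₃7GU klEngGeo14 P R →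
          ∀ μ ∈ klWindowC, ∀ U : ℝ, 0 < U → U ≤ klEngU₀12GQ klEngGeo14 (klEngQ9dG klEngGeo14 P R) P R c → ∀ β : ℝ, klBetaMin ≤ β → β ≤ Real.exp (c / U ^ 2) →
            ∀ (L M : ℕ) [NeZero L] [NeZero M], klEngL₄ P R β U ≤ L → klEngM₃ β U L ≤ M →
              ∀ n : ℕ, 1 ≤ n → n ≤ nScales β + 1 → IsKLRegime U c (-(n : ℤ)) →
                HistP klPredsV17F2 L M klEngGeo14 P (klEngQ9dG klEngGeo14 P R) R β U μ 0 n →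
                  FrameOK R U (nScales β) μ (klFlowFrameU L M β U μ n) →
                    KernelNormsV4 L M P (klEngQ9dG klEngGeo14 P R) β U μ (klFlowFrameU L M β U μ n) n →
                      (∀ j ≤ n, (KernelNormsLevels L M P (klEngQ9dG klEngGeo14 P R) β U μ (klFlowFrameU L M β U μ n) j ∧
                        KernelNormsWt4 L M (klWtBudget P (klEngQ9dG klEngGeo14 P R) U j) β U μ (klFlowFrameU L M β U μ n) j)) →
                        (∀ j ≤ n, LevelsUExportMixedAt L M (klCU2 P R (klEngQ7 P R)) P β U μ j) →
                          (∀ j ≤ n, IsoTupleLineBAt L M klE5AM klE5cM (klE5dM P R) P β U μ j) →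
                            (∀ j ≤ n, PairTransferRelFamilyK5 L M klEngGeoTh P (klCT8 P R (klEngQ7 P R) klEngGeo14 klEngGeoTh) β U μ j) →
            PairLadderStepAtV17F2 L M klEngGeo14 P (klEngQ9dG klEngGeo14 P R) β U μ n)
    (hexOut : ∀ (P : SplitConsts) (R : RenConsts) (c : ℝ), P.WF → R.WF2 → 0 < c → c ≤ klEngC₃7GU klEngGeo14 P R →
          ∀ μ ∈ klWindowC, ∀ U : ℝ, 0 < U → U ≤ klEngU₀12GQ klEngGeo14 (klEngQ9dG klEngGeo14 P R) P R c → ∀ β : ℝ, klBetaMin ≤ β → β ≤ Real.exp (c / U ^ 2) →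
            ∀ (L M : ℕ) [NeZero L] [NeZero M], klEngL₄ P R β U ≤ L → klEngM₃ β U L ≤ M →
              ∀ n : ℕ, 1 ≤ n → n ≤ nScales β + 1 → IsKLRegime U c (-(n : ℤ)) →
                HistP klPredsV17F2 L M klEngGeo14 P (klEngQ9dG klEngGeo14 P R) R β U μ 0 n →
                  FrameOK R U (nScales β) μ (klFlowFrameU L M β U μ n) →
                    KernelNormsV4 L M P (klEngQ9dG klEngGeo14 P R) β U μ (klFlowFrameU L M β U μ n) n →
                      (∀ j ≤ n, (KernelNormsLevels L M P (klEngQ9dG klEngGeo14 P R) β U μ (klFlowFrameU L M β U μ n) j ∧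
                        KernelNormsWt4 L M (klWtBudget P (klEngQ9dG klEngGeo14 P R) U j) β U μ (klFlowFrameU L M β U μ n) j)) →
                        (∀ j ≤ n, LevelsUExportMixedAt L M (klCU2 P R (klEngQ7 P R)) P β U μ j) →
                          (∀ j ≤ n, IsoTupleLineBAt L M klE5AM klE5cM (klE5dM P R) P β U μ j) →
                            (∀ j ≤ n, PairTransferRelFamilyK5 L M klEngGeoTh P (klCT8 P R (klEngQ7 P R) klEngGeo14 klEngGeoTh) β U μ j) →
            ∀ Qm : TorusSite 2 L, ¬ IsPairClassAt L Qm n → ∀ k ∈ klBall L μ 0, ∀ k' ∈ klBall L μ 0,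
              ‖klPairAmplitude L M β U μ (klFlowFrameU L M β U μ n) n Qm k k' -
                  klPairAmplitude L M β U μ (klFlowFrameU L M β U μ (n - 1)) (n - 1) Qm k k'‖ ≤
                gainBar klEngGeo14 P U n (klTorusNorm L Qm) (klTorusNorm L (k - k')) (klTorusNorm L (k + k' - Qm)) +
                  eremBar klEngGeo14 P (klEngQ9dG klEngGeo14 P R) U β L (n - 1) + thermalBar klEngGeo14 P U β n +
                    legDressBarQ2 klEngGeo14 P (klEngQ9dG klEngGeo14 P R) U n
                      (legSliceCountT L β μ (klFlowFrameU L M β U μ n) n ![k', Qm - k', Qm - k, k]) +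
                      frameShiftBar P (klEngQ9dG klEngGeo14 P R) U n)
    (hexIso : ∀ (P : SplitConsts) (R : RenConsts) (c : ℝ), P.WF → R.WF2 → 0 < c → c ≤ klEngC₃7GU klEngGeo14 P R →
          ∀ μ ∈ klWindowC, ∀ U : ℝ, 0 < U → U ≤ klEngU₀12GQ klEngGeo14 (klEngQ9dG klEngGeo14 P R) P R c → ∀ β : ℝ, klBetaMin ≤ β → β ≤ Real.exp (c / U ^ 2) →
            ∀ (L M : ℕ) [NeZero L] [NeZero M], klEngL₄ P R β U ≤ L → klEngM₃ β U L ≤ M →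
              ∀ n : ℕ, 1 ≤ n → n ≤ nScales β + 1 → IsKLRegime U c (-(n : ℤ)) →
                HistP klPredsV17F2 L M klEngGeo14 P (klEngQ9dG klEngGeo14 P R) R β U μ 0 n →
                  FrameOK R U (nScales β) μ (klFlowFrameU L M β U μ n) →
                    KernelNormsV4 L M P (klEngQ9dG klEngGeo14 P R) β U μ (klFlowFrameU L M β U μ n) n →
                      (∀ j ≤ n, (KernelNormsLevels L M P (klEngQ9dG klEngGeo14 P R) β U μ (klFlowFrameU L M β U μ n) j ∧
                        KernelNormsWt4 L M (klWtBudget P (klEngQ9dG klEngGeo14 P R) U j) β U μ (klFlowFrameU L M β U μ n) j)) →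
                        (∀ j ≤ n, LevelsUExportMixedAt L M (klCU2 P R (klEngQ7 P R)) P β U μ j) →
                          (∀ j ≤ n, IsoTupleLineBAt L M klE5AM klE5cM (klE5dM P R) P β U μ j) →
                            (∀ j ≤ n, PairTransferRelFamilyK5 L M klEngGeoTh P (klCT8 P R (klEngQ7 P R) klEngGeo14 klEngGeoTh) β U μ j) →
            IsoTupleL1AtV17F L M klEngGeo14 P β U μ n) :
    ∀ (P : SplitConsts) (R : RenConsts) (c : ℝ), P.WF → R.WF2 → 0 < c → c ≤ klEngC₃7GU klEngGeo14 P R →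
      ∀ μ ∈ klWindowC, ∀ U : ℝ, 0 < U → U ≤ klEngU₀12GQ klEngGeo14 (klEngQ9dG klEngGeo14 P R) P R c → ∀ β : ℝ, klBetaMin ≤ β → β ≤ Real.exp (c / U ^ 2) →
        ∀ (L M : ℕ) [NeZero L] [NeZero M], klEngL₄ P R β U ≤ L → klEngM₃ β U L ≤ M →
          ∀ n : ℕ, 1 ≤ n → n ≤ nScales β + 1 → IsKLRegime U c (-(n : ℤ)) →
            HistP klPredsV17F2 L M klEngGeo14 P (klEngQ9dG klEngGeo14 P R) R β U μ 0 n →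
              FrameOK R U (nScales β) μ (klFlowFrameU L M β U μ n) →
                KernelNormsV4 L M P (klEngQ9dG klEngGeo14 P R) β U μ (klFlowFrameU L M β U μ n) n →
                  (∀ j ≤ n, (KernelNormsLevels L M P (klEngQ9dG klEngGeo14 P R) β U μ (klFlowFrameU L M β U μ n) j ∧
                    KernelNormsWt4 L M (klWtBudget P (klEngQ9dG klEngGeo14 P R) U j) β U μ (klFlowFrameU L M β U μ n) j)) →
                    (∀ j ≤ n, LevelsUExportMixedAt L M (klCU2 P R (klEngQ7 P R)) P β U μ j) →
                      (∀ j ≤ n, IsoTupleLineBAt L M klE5AM klE5cM (klE5dM P R) P β U μ j) →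
                        (∀ j ≤ n, PairTransferRelFamilyK5 L M klEngGeoTh P (klCT8 P R (klEngQ7 P R) klEngGeo14 klEngGeoTh) β U μ j) →
                  PairLadderStepAtV17F2 L M klEngGeo14 P (klEngQ9dG klEngGeo14 P R) β U μ n ∧
                    PairValueIncrementAtV17F L M klEngGeo14 P (klEngQ9dG klEngGeo14 P R) β U μ n ∧
                      QuarticValueIncrementAtV17F L M klEngGeo14 P (klEngQ9dG klEngGeo14 P R) β U μ n ∧
                        IsoTupleL1AtV17F L M klEngGeo14 P β U μ n :=
  stub_engine_step_values_of_producers_GQd klEngGeo14 (by rw [klEngGeo14_bhi_eq]; norm_num) (le_of_eq klEngGeo14_bhi_eq)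
    (fun _ _ n hQm => klg14_package_ineq_of_isPairClassAt n hQm) hexLad hexOut hexIso

end Summit.HubbardSuperconductivity.HubbardSuperconductivity.Theorems.EngineV8.A24a1G14

end
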